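import Mathlib
import Summits.Ventures.PercRepro2.TwoHullMasterPrism
import Summits.Ventures.PercRepro2.TwoHullMasterBlockCheckRigid

/-!
# The RIGID (MM) on the triangular prism, `l` and `h` in different triangles (blind cell
PercRepro2, night-4 g40, 2026-08-29; proofs/NIGHT4-G40.md §7)

The vertex cover of TwoHullMasterPrism.lean is not rigid (5 of its 9 blocks fail the edge-pair
antitonicity at `h`); a rigid σ-symmetric cover with 10 blocks exists (`prismBlocksRigid`,
mining/night-4/g40/rigidcube.py).  The rigid checker accepts it by a kernel computation:
**`twoHullMasterRigid_prism`** is the rigid (MM) on the prism for every pair of up-sets, hence the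
lane's rigid row 2′SW-ALL for every mark (`swAll_prism`).
-/

namespace Summit.Ventures.PercRepro2

namespace Prism

open Hull LocRows SwCheck BlockCheck BlockCheckRigid

/-- The rigid cube cover of `U` for `l = 0`, `h = 1`: ten blocks `(base, classes)`. -/
def prismBlocksRigid : List (ℕ × List ℕ) :=
  [(504, [8, 164, 339]), (248, [8, 164, 339]), (120, [511]), (376, [511]), (440, [18, 493]),
    (312, [511]), (184, [109, 402]), (185, [511]), (57, [237, 274]), (56, [511])]

/-- The rigid checker accepts the cover (kernel computation). -/
theorem checkCoverRigid_prism : checkCoverRigid prismEdges 0 1 prismBlocksRigid = true := by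
  decide +kernel

/-- **The rigid (MM) on the triangular prism.** -/
theorem twoHullMasterRigid_prism : TwoHullMasterRigid (endsOf prismEdges) 0 1 :=
  twoHullMasterRigid_of_checkCoverRigid prismEdges 0 1 prismBlocksRigid checkCoverRigid_prism

/-- The rigid row 2′SW-ALL on the prism for every mark `o`. -/
theorem swAll_prism (o : Fin 6) : SwAll (endsOf prismEdges) 0 1 o :=
  swAll_of_twoHullMasterRigid o twoHullMasterRigid_prism

end Prism

end Summit.Ventures.PercRepro2
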